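import Mathlib
import Literature.Computability.AlgebraicComplexity.GroupTheoreticMatMul
import Literature.Barriers.MatrixMultiplication.TricoloredSumFreeBarrier
import Summits.MatrixMultiplication.MatrixMultiplication.Theorems.GroupTheoreticSTPPCThesisPackingSumset
import Summits.MatrixMultiplication.MatrixMultiplication.Theorems.AbelianSTPPCensusIteratedRoom

/-!
# The three-room energy rule (E3): the rooms of ONE member of an STPP family talk to each other (cell mm-stpp, eng-2 g4)

A necessary condition of a NEW KIND for census-STPP families (`IsSTPP`, CKSU 2005 Def. 5.1) in a finite abelian group
`G`, `|G| = M`: additive energy of the block set `W_t = A_t − B_t + C_t` of one member, summed over the WHOLE group.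
Fix a member `t` with `V = |A_t||B_t||C_t|` (`|W_t| = V` by the TPP) and slacks `s_C, s_A, s_B` of its three U14⁺ rooms
(tree `STPPPackingSumset.sum_card_mul_add_card_sumset_le` and its two rotations by `IsSTPP.rotate`):
`M ≤ V + Σ_{u≠t}|A_u||B_u| + s_C`, `M ≤ V + Σ_{u≠t}|B_u||C_u| + s_A`, `M ≤ V + Σ_{u≠t}|C_u||A_u| + s_B`.

* ROOM ⇒ POPULAR (theory g8, `STPPIteratedRoom.room_popular`): every `d ∈ C_t − C_t` has `|W_t ∩ (W_t + d)| ≥ V − s_C`.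
* **SIGN TRANSFER (`overlap_neg_add`, the new step):** for a direct sum `X + Y` (all sums distinct) the overlap function
  `d ↦ |S ∩ (S + d)|` is the same for `S = X + Y` and `S = −X + Y` (count the 4-tuples `(x, y, x', y')` with
  `(x + y) − (x' + y') = d`; swapping `x ↔ x'` flips the sign of the `X`-term).  Hence the rooms of the ROTATED families,
  whose block sets are `B_t − C_t + A_t` and `C_t − A_t + B_t`, make every `d ∈ A_t − A_t` resp. `B_t − B_t` a
  `(V − s_A)`- resp. `(V − s_B)`-popular difference OF THE SAME SET `W_t` (`popular_A`, `popular_B`).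
* SUB-ADDITIVITY (`STPPIteratedRoom.overlap_add`) along `g = d_A + d_B + d_C`: every `g ∈ W_t − W_t` is
  `(V − s_A − s_B − s_C)`-popular; and `W_t − W_t = G` as soon as `2V > M` (two `V`-sets in `G` meet) (`popular_all`).
* DOUBLE COUNTING (`STPPIteratedRoom.card_mul_le_card_sq`, `Σ_g |W ∩ (W + g)| = V²`):
  **E3: if `2V > M` then `M · (V − s_A − s_B − s_C) ≤ V²`** (`three_room_energy`), i.e. on shape data
  `Σ_{u≠t}(a_u b_u + b_u c_u + c_u a_u) ≤ (M − V)(3M − V)/M` for every member with `2V > M`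
  (the three packings alone give `3(M − V)`).  Kill schema `false_of_energy3` (arithmetic by `decide`).

Instances (each ALIVE under the cell's shape sieve vP — `shapeExclusionVP_false_at_338` etc. — and under U14-K):
`no_755_666_666_666_at_338` (R-5 Q-i of HOME/KILL-MEMO: the first vP-alive list; `338·161 = 54418 > 46656 = 216²`),
`no_765_666_666_665_at_338` (the other vP-alive class at 338), `no_666x4_at_350`, `no_666x4_at_351`,
`no_7774_311_at_521` (the first vP-alive prime), `no_667_667_676_676_766_766_at_474` (the `T_A` witnesses at the
knapsack ceiling 474).  Seat numerics (HOME/mm-stpp-eng-2/energy3/): E3 kills 839 of the 844 recorded vP-alive `T_E`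
witness leaves at orders 338–420; survivors `(6,6,6)⁴` at 352, `(6,6,6)⁴+(1,1,2)` at 354, `(7,6,6)⁴+(3,3,2)` at 412.
WHAT THIS IS NOT: no `ω` statement, no census row, no construction; a necessary condition; nothing about orders where a
leaf survives E3 (352, 354, 412, …) nor about non-abelian hosts.
-/

-- single-conjunct summit: the mandated namespace repeats `MatrixMultiplication`.
set_option linter.dupNamespace false

namespace Summit.MatrixMultiplication.MatrixMultiplication.Theorems

namespace STPPThreeRoomEnergy

open Finset Literature.Computability.AlgebraicComplexity
open scoped Pointwise

variable {G : Type*} [AddCommGroup G] [DecidableEq G]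

/-! ## Sign transfer for direct sums -/

/-- `|W ∩ (W + d)|` counted as ordered pairs: `#{w ∈ W : w − d ∈ W} = #{(w, w') ∈ W × W : w − w' = d}`. [folklore] -/
theorem overlap_eq_card_filter_prod (W : Finset G) (d : G) :
    (W.filter (· - d ∈ W)).card = ((W ×ˢ W).filter fun p : G × G => p.1 - p.2 = d).card := by
  refine card_nbij' (fun w => (w, w - d)) (fun p => p.1) ?_ ?_ (fun w _ => rfl) ?_
  · intro w hw
    rw [mem_coe, mem_filter] at hw
    rw [mem_coe, mem_filter, mem_product]
    exact ⟨⟨hw.1, hw.2⟩, sub_sub_cancel w d⟩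
  · intro p hp
    rw [mem_coe, mem_filter, mem_product] at hp
    rw [mem_coe, mem_filter]
    refine ⟨hp.1.1, ?_⟩
    have : p.1 - d = p.2 := by rw [← hp.2]; abel
    rw [this]; exact hp.1.2
  · intro p hp
    rw [mem_coe, mem_filter] at hp
    have : p.1 - d = p.2 := by rw [← hp.2]; abel
    exact Prod.ext rfl this

omit [AddCommGroup G] in
/-- Pairs of an injective image: `#{(u, v) ∈ φ(P) × φ(P) : F (u, v)} = #{(p, q) ∈ P × P : F (φ p, φ q)}` for `φ` injective
on `P`. [bookkeeping] -/
theorem card_filter_image_prod {α : Type*} [DecidableEq α] (P : Finset α) (φ : α → G) (hφ : Set.InjOn φ P)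
    (F : G × G → Prop) [DecidablePred F] :
    (((P.image φ) ×ˢ (P.image φ)).filter F).card = ((P ×ˢ P).filter fun pq : α × α => F (φ pq.1, φ pq.2)).card := by
  have e : (P.image φ) ×ˢ (P.image φ) = (P ×ˢ P).image (Prod.map φ φ) := by
    ext ⟨u, v⟩
    simp only [mem_product, mem_image, Prod.exists, Prod.map_apply, Prod.mk.injEq]
    constructor
    · rintro ⟨⟨p, hp, rfl⟩, q, hq, rfl⟩
      exact ⟨p, q, ⟨hp, hq⟩, rfl, rfl⟩
    · rintro ⟨p, q, ⟨hp, hq⟩, rfl, rfl⟩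
      exact ⟨⟨p, hp, rfl⟩, q, hq, rfl⟩
  rw [e, filter_image, card_image_of_injOn]
  · rfl
  · have h2 : Set.InjOn (Prod.map φ φ) (↑P ×ˢ ↑P : Set (α × α)) := hφ.prodMap hφ
    intro x hx y hy hxy
    rw [mem_coe, mem_filter, ← mem_coe, coe_product] at hx hy
    exact h2 hx.1 hy.1 hxy

/-- **Sign transfer.**  If `X + Y` is direct (`|X + Y| = |X||Y|`), then for every `d` the sets `X + Y` and `−X + Y` have the
same number of pairs at difference `d`: `#{w ∈ −X+Y : w − d ∈ −X+Y} = #{w ∈ X+Y : w − d ∈ X+Y}`.  (Both count 4-tuples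
`(x, y, x', y') ∈ (X × Y)²`; the swap `x ↔ x'` turns `(−x + y) − (−x' + y') = d` into `(x' + y) − (x + y') = d`.
Fourier reading: `|1̂_{±X+Y}| = |1̂_X|·|1̂_Y|` for both signs.) [original] -/
theorem overlap_neg_add (X Y : Finset G) (hXY : (X + Y).card = X.card * Y.card) (d : G) :
    ((-X + Y).filter (· - d ∈ -X + Y)).card = ((X + Y).filter (· - d ∈ X + Y)).card := by
  set P : Finset (G × G) := X ×ˢ Y with hP
  have himgP : P.image (fun p : G × G => p.1 + p.2) = X + Y := image_add_product
  have himgN : P.image (fun p : G × G => -p.1 + p.2) = -X + Y := by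
    ext z
    rw [mem_image, mem_add]
    constructor
    · rintro ⟨⟨x, y⟩, hp, rfl⟩
      rw [hP, mem_product] at hp
      exact ⟨-x, neg_mem_neg hp.1, y, hp.2, rfl⟩
    · rintro ⟨x', hx', y, hy, rfl⟩
      rw [mem_neg'] at hx'
      exact ⟨(-x', y), by rw [hP, mem_product]; exact ⟨hx', hy⟩, by simp only [neg_neg]⟩
  have hinjP : Set.InjOn (fun p : G × G => p.1 + p.2) ↑P := by
    rw [← card_image_iff, himgP, hXY, hP, card_product]
  have hinjN : Set.InjOn (fun p : G × G => -p.1 + p.2) ↑P := by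
    rintro ⟨x, y⟩ hp ⟨x', y'⟩ hq he
    have he' : (x', y).1 + (x', y).2 = (x, y').1 + (x, y').2 := by
      have : -x + y = -x' + y' := he
      have h3 : x' + y = x + y' := by
        calc x' + y = (x + x') + (-x + y) := by abel
          _ = (x + x') + (-x' + y') := by rw [this]
          _ = x + y' := by abel
      exact h3
    rw [hP, coe_product] at hp hq
    have hp' : ((x', y) : G × G) ∈ (↑X ×ˢ ↑Y : Set (G × G)) := ⟨hq.1, hp.2⟩
    have hq' : ((x, y') : G × G) ∈ (↑X ×ˢ ↑Y : Set (G × G)) := ⟨hp.1, hq.2⟩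
    rw [hP, coe_product] at hinjP
    have := hinjP hp' hq' he'
    simp only [Prod.mk.injEq] at this
    exact Prod.ext this.1.symm this.2
  rw [← himgN, ← himgP, overlap_eq_card_filter_prod, overlap_eq_card_filter_prod,
    card_filter_image_prod P _ hinjN, card_filter_image_prod P _ hinjP]
  -- the swap `(x, y, x', y') ↦ (x', y, x, y')`
  refine card_nbij' (fun pq => ((pq.2.1, pq.1.2), (pq.1.1, pq.2.2))) (fun pq => ((pq.2.1, pq.1.2), (pq.1.1, pq.2.2)))
    ?_ ?_ (fun pq _ => rfl) (fun pq _ => rfl)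
  · rintro ⟨⟨x, y⟩, ⟨x', y'⟩⟩ hpq
    rw [mem_coe, mem_filter, mem_product, hP, mem_product, mem_product] at hpq
    rw [mem_coe, mem_filter, mem_product, hP, mem_product, mem_product]
    refine ⟨⟨⟨hpq.1.2.1, hpq.1.1.2⟩, hpq.1.1.1, hpq.1.2.2⟩, ?_⟩
    have e : x' + y - (x + y') = -x + y - (-x' + y') := by abel
    simp only
    rw [e]; exact hpq.2
  · rintro ⟨⟨x, y⟩, ⟨x', y'⟩⟩ hpq
    rw [mem_coe, mem_filter, mem_product, hP, mem_product, mem_product] at hpq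
    rw [mem_coe, mem_filter, mem_product, hP, mem_product, mem_product]
    refine ⟨⟨⟨hpq.1.2.1, hpq.1.1.2⟩, hpq.1.1.1, hpq.1.2.2⟩, ?_⟩
    have e : -x' + y - (-x + y') = x + y - (x' + y') := by abel
    simp only
    rw [e]; exact hpq.2

/-! ## The STPP application: all three difference sets are popular for the SAME block set `W_t = A_t − B_t + C_t` -/

variable [Fintype G] {N : ℕ} {A B C : Fin N → Finset G}

omit [Fintype G] in
/-- Transfer between the block sets of a member and of its rotation: `B_t − C_t + A_t` (rotated family) and
`A_t − B_t + C_t` have the same overlap function. [original] -/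
theorem overlap_rotate_eq (h : IsSTPP A B C) (hA : ∀ u, (A u).Nonempty) (t : Fin N) (d : G) :
    ((B t - C t + A t).filter (· - d ∈ B t - C t + A t)).card =
      ((A t - B t + C t).filter (· - d ∈ A t - B t + C t)).card := by
  have hXY : (B t - C t + A t).card = (B t - C t).card * (A t).card := by
    rw [STPPIteratedRoom.card_sub_add_eq h.rotate t, STPPPackingSumset.card_sub_eq h.rotate t (hA t)]
  have e : A t - B t + C t = -(B t - C t) + A t := by
    rw [neg_sub, sub_eq_add_neg, sub_eq_add_neg, add_right_comm (C t) (-B t) (A t), add_comm (C t) (A t),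
      add_right_comm]
  rw [e]
  exact (overlap_neg_add (B t - C t) (A t) hXY d).symm

/-- **`A`-differences are popular for `W_t`.**  With all sets non-empty and `|G| ≤ V + Σ_{u≠t}|B_u||C_u| + s_A`:
every `d ∈ A_t − A_t` has `V ≤ |W_t ∩ (W_t + d)| + s_A`, `W_t = A_t − B_t + C_t`. [original] -/
theorem popular_A (h : IsSTPP A B C) (hA : ∀ u, (A u).Nonempty) (t : Fin N) (sA : ℕ)
    (hsA : Fintype.card G ≤ (A t).card * (B t).card * (C t).card +
      (∑ u ∈ univ.erase t, (B u).card * (C u).card) + sA) :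
    ∀ d ∈ A t - A t, (A t - B t + C t).card ≤
      ((A t - B t + C t).filter (· - d ∈ A t - B t + C t)).card + sA := by
  intro d hd
  have e : (B t).card * (C t).card * (A t).card = (A t).card * (B t).card * (C t).card := by ring
  have := STPPIteratedRoom.room_popular h.rotate hA t sA (by rw [e]; exact hsA) d hd
  rw [overlap_rotate_eq h hA t d, STPPIteratedRoom.card_sub_add_eq h.rotate t, e] at this
  rwa [STPPIteratedRoom.card_sub_add_eq h t]

/-- **`B`-differences are popular for `W_t`.**  With all sets non-empty and `|G| ≤ V + Σ_{u≠t}|C_u||A_u| + s_B`: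
every `d ∈ B_t − B_t` has `V ≤ |W_t ∩ (W_t + d)| + s_B`. [original] -/
theorem popular_B (h : IsSTPP A B C) (hA : ∀ u, (A u).Nonempty) (hB : ∀ u, (B u).Nonempty) (t : Fin N) (sB : ℕ)
    (hsB : Fintype.card G ≤ (A t).card * (B t).card * (C t).card +
      (∑ u ∈ univ.erase t, (C u).card * (A u).card) + sB) :
    ∀ d ∈ B t - B t, (A t - B t + C t).card ≤
      ((A t - B t + C t).filter (· - d ∈ A t - B t + C t)).card + sB := by
  intro d hd
  have e : (C t).card * (A t).card * (B t).card = (A t).card * (B t).card * (C t).card := by ring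
  have := STPPIteratedRoom.room_popular h.rotate.rotate hB t sB (by rw [e]; exact hsB) d hd
  rw [overlap_rotate_eq h.rotate hB t d, overlap_rotate_eq h hA t d,
    STPPIteratedRoom.card_sub_add_eq h.rotate.rotate t, e] at this
  rwa [STPPIteratedRoom.card_sub_add_eq h t]

/-- **Every group element is popular.**  With the three slacks as above and `2V > |G|`: for every `g : G`,
`V ≤ |W_t ∩ (W_t + g)| + (s_A + s_B + s_C)` (`W_t − W_t = G`, and `g = d_A + d_B + d_C` composes by sub-additivity).
[original] -/
theorem popular_all (h : IsSTPP A B C) (hA : ∀ u, (A u).Nonempty) (hB : ∀ u, (B u).Nonempty)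
    (hC : ∀ u, (C u).Nonempty) (t : Fin N) (sA sB sC : ℕ)
    (hsA : Fintype.card G ≤ (A t).card * (B t).card * (C t).card +
      (∑ u ∈ univ.erase t, (B u).card * (C u).card) + sA)
    (hsB : Fintype.card G ≤ (A t).card * (B t).card * (C t).card +
      (∑ u ∈ univ.erase t, (C u).card * (A u).card) + sB)
    (hsC : Fintype.card G ≤ (A t).card * (B t).card * (C t).card +
      (∑ u ∈ univ.erase t, (A u).card * (B u).card) + sC)
    (hbig : Fintype.card G < 2 * ((A t).card * (B t).card * (C t).card)) (g : G) :
    (A t - B t + C t).card ≤ ((A t - B t + C t).filter (· - g ∈ A t - B t + C t)).card + (sA + sB + sC) := by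
  have hV : (A t - B t + C t).card = (A t).card * (B t).card * (C t).card := STPPIteratedRoom.card_sub_add_eq h t
  -- `W − W = G`: some `w ∈ W` has `w − g ∈ W`
  obtain ⟨w, hw, hwg⟩ : ∃ w ∈ A t - B t + C t, w - g ∈ A t - B t + C t := by
    by_contra hcon
    push Not at hcon
    have hdisj : Disjoint (A t - B t + C t) ((A t - B t + C t).image (· + g)) := by
      rw [disjoint_left]
      intro w hw hw'
      rw [mem_image] at hw'
      obtain ⟨w', hw', rfl⟩ := hw'
      exact hcon _ hw (by rwa [add_sub_cancel_right])
    have h1 := card_le_univ ((A t - B t + C t) ∪ (A t - B t + C t).image (· + g))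
    rw [card_union_of_disjoint hdisj, card_image_of_injective _ (add_left_injective g)] at h1
    omega
  -- decompose `g = (a − a') + ((b' − b) + (c − c'))`
  obtain ⟨x, hx, c, hc, rfl⟩ := mem_add.1 hw
  obtain ⟨a, ha, b, hb, rfl⟩ := mem_sub.1 hx
  obtain ⟨x', hx', c', hc', he⟩ := mem_add.1 hwg
  obtain ⟨a', ha', b', hb', rfl⟩ := mem_sub.1 hx'
  have hg : g = (a - a') + ((b' - b) + (c - c')) := by
    have : g = (a - b + c) - (a' - b' + c') := by rw [he]; abel
    rw [this]; abel
  have h1 := popular_A h hA t sA hsA (a - a') (sub_mem_sub ha ha')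
  have h2 := popular_B h hA hB t sB hsB (b' - b) (sub_mem_sub hb' hb)
  have h3 := STPPIteratedRoom.room_popular h hC t sC hsC (c - c') (sub_mem_sub hc hc')
  have h4 := STPPIteratedRoom.overlap_add (A t - B t + C t) (b' - b) (c - c')
  have h5 := STPPIteratedRoom.overlap_add (A t - B t + C t) (a - a') ((b' - b) + (c - c'))
  rw [hg]
  omega

/-- **The three-room energy rule (E3).**  For an `IsSTPP` family with all sets non-empty in a finite abelian group `G`,
a member `t` with `V = |A_t||B_t||C_t| > |G|/2`, and slacks `s_A, s_B, s_C` of its three U14⁺ rooms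
(`|G| ≤ V + Σ_{u≠t}|B_u||C_u| + s_A`, `|G| ≤ V + Σ_{u≠t}|C_u||A_u| + s_B`, `|G| ≤ V + Σ_{u≠t}|A_u||B_u| + s_C`):
**`|G| · (V − (s_A + s_B + s_C)) ≤ V²`** (truncated subtraction). [original] -/
theorem three_room_energy (h : IsSTPP A B C) (hA : ∀ u, (A u).Nonempty) (hB : ∀ u, (B u).Nonempty)
    (hC : ∀ u, (C u).Nonempty) (t : Fin N) (sA sB sC : ℕ)
    (hsA : Fintype.card G ≤ (A t).card * (B t).card * (C t).card +
      (∑ u ∈ univ.erase t, (B u).card * (C u).card) + sA)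
    (hsB : Fintype.card G ≤ (A t).card * (B t).card * (C t).card +
      (∑ u ∈ univ.erase t, (C u).card * (A u).card) + sB)
    (hsC : Fintype.card G ≤ (A t).card * (B t).card * (C t).card +
      (∑ u ∈ univ.erase t, (A u).card * (B u).card) + sC)
    (hbig : Fintype.card G < 2 * ((A t).card * (B t).card * (C t).card)) :
    Fintype.card G * ((A t).card * (B t).card * (C t).card - (sA + sB + sC)) ≤
      ((A t).card * (B t).card * (C t).card) ^ 2 := by
  have hV : (A t - B t + C t).card = (A t).card * (B t).card * (C t).card := STPPIteratedRoom.card_sub_add_eq h t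
  have := STPPIteratedRoom.card_mul_le_card_sq (A t - B t + C t) univ
    ((A t).card * (B t).card * (C t).card - (sA + sB + sC)) (fun g _ => by
      have := popular_all h hA hB hC t sA sB sC hsA hsB hsC hbig g
      omega)
  rwa [card_univ, hV] at this

/-! ## Kill schema on shape data -/

/-- **Kill schema (E3).**  Shape data `a, b, c` (all positive) of an `IsSTPP` family in an abelian group of order `M`, a member
`t` with `V = a_t b_t c_t`, `2V > M`, and the three off-member packing sums `S_C = Σ_{u≠t} a_u b_u`, `S_A = Σ_{u≠t} b_u c_u`,
`S_B = Σ_{u≠t} c_u a_u`: if `V² < M · (V − ((M − (V + S_A)) + (M − (V + S_B)) + (M − (V + S_C))))` (truncated), the family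
does not exist. [original] -/
theorem false_of_energy3 (h : IsSTPP A B C) {a b c : Fin N → ℕ} (ha : ∀ r, (A r).card = a r)
    (hb : ∀ r, (B r).card = b r) (hc : ∀ r, (C r).card = c r) (hpos : ∀ r, 0 < a r ∧ 0 < b r ∧ 0 < c r)
    {M : ℕ} (hM : Fintype.card G = M) (t : Fin N) (SA SB SC : ℕ)
    (hSA : SA = ∑ u ∈ univ.erase t, b u * c u) (hSB : SB = ∑ u ∈ univ.erase t, c u * a u)
    (hSC : SC = ∑ u ∈ univ.erase t, a u * b u) (hbig : M < 2 * (a t * b t * c t))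
    (hkill : (a t * b t * c t) ^ 2 <
      M * (a t * b t * c t - ((M - (a t * b t * c t + SA)) + (M - (a t * b t * c t + SB)) +
        (M - (a t * b t * c t + SC))))) :
    False := by
  classical
  have hA : ∀ u, (A u).Nonempty := fun u => card_pos.1 (by rw [ha u]; exact (hpos u).1)
  have hB : ∀ u, (B u).Nonempty := fun u => card_pos.1 (by rw [hb u]; exact (hpos u).2.1)
  have hC : ∀ u, (C u).Nonempty := fun u => card_pos.1 (by rw [hc u]; exact (hpos u).2.2)
  have eA : ∑ u ∈ univ.erase t, (B u).card * (C u).card = SA := by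
    rw [hSA]; exact sum_congr rfl fun u _ => by rw [hb u, hc u]
  have eB : ∑ u ∈ univ.erase t, (C u).card * (A u).card = SB := by
    rw [hSB]; exact sum_congr rfl fun u _ => by rw [hc u, ha u]
  have eC : ∑ u ∈ univ.erase t, (A u).card * (B u).card = SC := by
    rw [hSC]; exact sum_congr rfl fun u _ => by rw [ha u, hb u]
  have := three_room_energy h hA hB hC t (M - (a t * b t * c t + SA)) (M - (a t * b t * c t + SB))
    (M - (a t * b t * c t + SC)) (by rw [eA, ha t, hb t, hc t, hM]; omega)
    (by rw [eB, ha t, hb t, hc t, hM]; omega) (by rw [eC, ha t, hb t, hc t, hM]; omega)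
    (by rw [ha t, hb t, hc t, hM]; exact hbig)
  rw [ha t, hb t, hc t, hM] at this
  exact absurd this (not_le.2 hkill)

/-! ## Instances: the first vP-alive lists -/

/-- **Order 338, shapes `(7,5,5),(6,6,6),(6,6,6),(6,6,6)`: impossible in every abelian group of order 338** (R-5 Q-i of the
cell's KILL-MEMO; the FIRST list alive under the shape sieve vP, `shapeExclusionVP_false_at_338`).  Member `1`: `V = 216 > 169`,
rooms `231, 241, 231` (slacks `15, 25, 15`), `338 · (216 − 55) = 54418 > 46656 = 216²`. [original] -/
theorem no_755_666_666_666_at_338 {A B C : Fin 4 → Finset G} (h : IsSTPP A B C)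
    (hA : ∀ r, (A r).card = ![7, 6, 6, 6] r) (hB : ∀ r, (B r).card = ![5, 6, 6, 6] r)
    (hC : ∀ r, (C r).card = ![5, 6, 6, 6] r) (hM : Fintype.card G = 338) : False :=
  false_of_energy3 h hA hB hC (by decide) hM 1 97 107 107 (by decide) (by decide) (by decide) (by decide) (by decide)

/-- **Order 338, shapes `(7,6,5),(6,6,6),(6,6,6),(6,6,5)`: impossible** (the other vP-alive class at 338; member `1`:
off-member sums `S_A = 96, S_B = 101, S_C = 114`, slacks `26, 21, 8`, `338 · 161 = 54418 > 46656`). [original] -/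
theorem no_765_666_666_665_at_338 {A B C : Fin 4 → Finset G} (h : IsSTPP A B C)
    (hA : ∀ r, (A r).card = ![7, 6, 6, 6] r) (hB : ∀ r, (B r).card = ![6, 6, 6, 6] r)
    (hC : ∀ r, (C r).card = ![5, 6, 6, 5] r) (hM : Fintype.card G = 338) : False :=
  false_of_energy3 h hA hB hC (by decide) hM 1 96 101 114 (by decide) (by decide) (by decide) (by decide) (by decide)

/-- **Order 350, shapes `(6,6,6)⁴`: impossible** (the uniform cap family covering 350 in the planner's stage-A table; member
`0`: all three off-member sums `108`, slacks `26`, `350 · 138 = 48300 > 46656`).  At order 352 the same list PASSES E3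
(`352 · 132 = 46464 ≤ 46656`). [original] -/
theorem no_666x4_at_350 {A B C : Fin 4 → Finset G} (h : IsSTPP A B C)
    (hA : ∀ r, (A r).card = ![6, 6, 6, 6] r) (hB : ∀ r, (B r).card = ![6, 6, 6, 6] r)
    (hC : ∀ r, (C r).card = ![6, 6, 6, 6] r) (hM : Fintype.card G = 350) : False :=
  false_of_energy3 h hA hB hC (by decide) hM 0 108 108 108 (by decide) (by decide) (by decide) (by decide) (by decide)

/-- **Order 351, shapes `(6,6,6)⁴`: impossible** (`351 · 135 = 47385 > 46656`). [original] -/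
theorem no_666x4_at_351 {A B C : Fin 4 → Finset G} (h : IsSTPP A B C)
    (hA : ∀ r, (A r).card = ![6, 6, 6, 6] r) (hB : ∀ r, (B r).card = ![6, 6, 6, 6] r)
    (hC : ∀ r, (C r).card = ![6, 6, 6, 6] r) (hM : Fintype.card G = 351) : False :=
  false_of_energy3 h hA hB hC (by decide) hM 0 108 108 108 (by decide) (by decide) (by decide) (by decide) (by decide)

/-- **Order 521 (prime), shapes `(7,7,7)⁴ + (3,1,1)`: impossible** (the first vP-alive prime, `shapeExclusionVP_false_at_prime_521`;
member `0`: `V = 343 > 260`, off-member sums `148, 150, 150`, slacks `30, 28, 28`, `521 · 257 = 133897 > 117649 = 343²`).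
[original] -/
theorem no_7774_311_at_521 {A B C : Fin 5 → Finset G} (h : IsSTPP A B C)
    (hA : ∀ r, (A r).card = ![7, 7, 7, 7, 3] r) (hB : ∀ r, (B r).card = ![7, 7, 7, 7, 1] r)
    (hC : ∀ r, (C r).card = ![7, 7, 7, 7, 1] r) (hM : Fintype.card G = 521) : False :=
  false_of_energy3 h hA hB hC (by decide) hM 0 148 150 150 (by decide) (by decide) (by decide) (by decide) (by decide)

/-- **Order 474, shapes `(6,6,7)²,(6,7,6)²,(7,6,6)²`: impossible** (the witnesses of the `T_A` knapsack ceiling,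
`TAKnap.vmCensusTA_false_at_474`; member `0`: `V = 252 > 237`, off-member sums `198, 198, 204`, slacks `24, 24, 18`,
`474 · 186 = 88164 > 63504 = 252²`). [original] -/
theorem no_667_667_676_676_766_766_at_474 {A B C : Fin 6 → Finset G} (h : IsSTPP A B C)
    (hA : ∀ r, (A r).card = ![6, 6, 6, 6, 7, 7] r) (hB : ∀ r, (B r).card = ![6, 6, 7, 7, 6, 6] r)
    (hC : ∀ r, (C r).card = ![7, 7, 6, 6, 6, 6] r) (hM : Fintype.card G = 474) : False :=
  false_of_energy3 h hA hB hC (by decide) hM 0 198 198 204 (by decide) (by decide) (by decide) (by decide) (by decide)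

end STPPThreeRoomEnergy

end Summit.MatrixMultiplication.MatrixMultiplication.Theorems
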